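import Mathlib
import Summits.Ventures.PercRepro2.SwOutCrossGenJointDefs

/-!
# The product of two dropped components with a JOINT label: the inequality (blind cell
PercRepro2, night-4 g25, 2026-08-28; proofs/NIGHT4-G25.md §1)

The proof of `ineq_prod` (`SwOutCrossGenProdThm`, `SwOutCrossGenProdNC`) with the joint label in
place of the product label: at a core point `c` of the second component the first cube's
inequality applies at frozen `c` with the up-set sliced through `g` (`card_frozen_lePJ`), the core
points of the second component are paired `c ↔ flip c` at a fixed point of the first cube
(`card_pairPJ_le`, by `pairJ`), and the non-core points of the second component live on the slabs
and are injected through `theta₁ × psi₂` (`card_nc_lePJ`, by `ncJ`).  **`ineq_prodL`**: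
`Ineq F₁ ι → Ineq (F₁.prodL F₂ J) ι` for every joint label `J`.
-/

namespace Summit.Ventures.PercRepro2

namespace CrossArm

section Frozen

variable {W₁ A₁ L₁ W₂ A₂ L₂ : Type*} {ι : Type*} {F₁ : FibreIter W₁ A₁ L₁}
  {F₂ : FibreDataBit W₂ A₂ L₂} {LJ : Type*} (J : JointLabel F₁ F₂ LJ)

variable [Fintype ι] [DecidableEq ι] [Fintype W₁] [DecidableEq W₁] [Fintype W₂] [DecidableEq W₂]

open scoped Classical

omit [DecidableEq W₁] in
/-- **Step 1, the frozen inequality at a core point `c` of the second component.** -/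
lemma card_frozen_lePJ (hineq : Ineq F₁ (ι := ι)) {𝒯 : Set (TypG LJ ι)} (h𝒯 : IsUpPJ J 𝒯)
    {𝓔 : Set (Set (AtomPr A₁ A₂ ι))} (h𝓔 : IsUpperSet 𝓔) (c : W₂) (hc : F₂.core c = true) :
    ((QPJ J 𝒯).filter fun x => x.2.2 = c ∧ ERP F₁ F₂ x ∈ 𝓔).card ≤
      ((QPJ J 𝒯).filter fun x => x.2.2 = c ∧ EBpreP F₁ F₂ c x ∈ 𝓔).card := by
  have key := hineq _ _ (isUpI_sliceTPJ J h𝒯 hc) (isUpperSet_sliceEP F₂ h𝓔 c)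
  have htyp : ∀ x : PtP W₁ W₂ ι, x.2.2 = c →
      (typPJ J x ∈ 𝒯 ↔ typI F₁ (x.1, x.2.1) ∈ sliceTPJ J 𝒯 c) := by
    intro x hxc
    simp only [typPJ, typI, sliceTPJ, Set.mem_setOf_eq, hxc, J.labelJ_core x.2.1 c hc]
  have e1 : ((QPJ J 𝒯).filter fun x => x.2.2 = c ∧ ERP F₁ F₂ x ∈ 𝓔).card =
      ((QI F₁ (sliceTPJ J 𝒯 c)).filter fun q => ERI F₁ q ∈ sliceEP F₂ 𝓔 c).card := by
    refine Finset.card_bij' (fun x _ => (x.1, x.2.1)) (fun q _ => (q.1, q.2, c)) ?_ ?_ ?_ ?_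
    · intro x hx
      rw [Finset.mem_filter, mem_QPJ] at hx
      obtain ⟨⟨hl, ht⟩, hxc, hE⟩ := hx
      rw [Finset.mem_filter, mem_QI]
      refine ⟨⟨?_, (htyp x hxc).1 ht⟩, (ERP_mem_iff F₁ F₂ hxc).1 hE⟩
      rwa [leakP_core_iff F₁ F₂ (by rw [hxc]; exact hc)] at hl
    · intro q hq
      rw [Finset.mem_filter, mem_QI] at hq
      obtain ⟨⟨hl, ht⟩, hE⟩ := hq
      rw [Finset.mem_filter, mem_QPJ]
      refine ⟨⟨?_, (htyp (q.1, q.2, c) rfl).2 ht⟩, rfl, (ERP_mem_iff F₁ F₂ rfl).2 hE⟩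
      rw [leakP_core_iff F₁ F₂ hc]; exact hl
    · intro x hx
      rw [Finset.mem_filter] at hx
      exact Prod.ext rfl (Prod.ext rfl hx.2.1.symm)
    · intro q _
      rfl
  have e2 : ((QPJ J 𝒯).filter fun x => x.2.2 = c ∧ EBpreP F₁ F₂ c x ∈ 𝓔).card =
      ((QI F₁ (sliceTPJ J 𝒯 c)).filter fun q => EBI F₁ q ∈ sliceEP F₂ 𝓔 c).card := by
    refine Finset.card_bij' (fun x _ => (x.1, x.2.1)) (fun q _ => (q.1, q.2, c)) ?_ ?_ ?_ ?_
    · intro x hx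
      rw [Finset.mem_filter, mem_QPJ] at hx
      obtain ⟨⟨hl, ht⟩, hxc, hE⟩ := hx
      rw [Finset.mem_filter, mem_QI]
      refine ⟨⟨?_, (htyp x hxc).1 ht⟩, (EBpreP_mem_iff F₁ F₂ c).1 hE⟩
      rwa [leakP_core_iff F₁ F₂ (by rw [hxc]; exact hc)] at hl
    · intro q hq
      rw [Finset.mem_filter, mem_QI] at hq
      obtain ⟨⟨hl, ht⟩, hE⟩ := hq
      rw [Finset.mem_filter, mem_QPJ]
      refine ⟨⟨?_, (htyp (q.1, q.2, c) rfl).2 ht⟩, rfl, (EBpreP_mem_iff F₁ F₂ c).2 hE⟩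
      rw [leakP_core_iff F₁ F₂ hc]; exact hl
    · intro x hx
      rw [Finset.mem_filter] at hx
      exact Prod.ext rfl (Prod.ext rfl hx.2.1.symm)
    · intro q _
      rfl
  rw [e1, e2]
  exact key

/-- **Step 2, the pairing at a fixed point of the first cube**: the frozen blue count is at most
the true one. -/
lemma card_pairPJ_le {𝒯 : Set (TypG LJ ι)} (h𝒯 : IsUpPJ J 𝒯) {𝓔 : Set (Set (AtomPr A₁ A₂ ι))}
    (h𝓔 : IsUpperSet 𝓔) (q : PtG W₁ ι) :
    ((QPJ J 𝒯).filter fun x => (x.1, x.2.1) = q ∧ F₂.core x.2.2 = true ∧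
        EBpreP F₁ F₂ x.2.2 x ∈ 𝓔).card ≤
      ((QPJ J 𝒯).filter fun x => (x.1, x.2.1) = q ∧ F₂.core x.2.2 = true ∧ EBP F₁ F₂ x ∈ 𝓔).card := by
  let P : W₂ → Prop := fun c => (q.1, q.2, c) ∈ QPJ J 𝒯
  let E : W₂ → Prop := fun c => EBpreP F₁ F₂ c (q.1, q.2, c) ∈ 𝓔
  have e1 : ((QPJ J 𝒯).filter fun x => (x.1, x.2.1) = q ∧ F₂.core x.2.2 = true ∧
      EBpreP F₁ F₂ x.2.2 x ∈ 𝓔).card = ∑ c ∈ coreAll F₂.toFibreData, if P c ∧ E c then 1 else 0 := by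
    rw [Finset.card_eq_sum_card_fiberwise (f := fun x => x.2.2) (t := coreAll F₂.toFibreData)
      (fun x hx => mem_coreAll_of_core (Finset.mem_filter.1 hx).2.2.1)]
    refine Finset.sum_congr rfl fun c hc => ?_
    rw [Finset.filter_filter]
    have : ((QPJ J 𝒯).filter fun x => ((x.1, x.2.1) = q ∧ F₂.core x.2.2 = true ∧
        EBpreP F₁ F₂ x.2.2 x ∈ 𝓔) ∧ x.2.2 = c) =
        (QPJ J 𝒯).filter fun x => x = (q.1, q.2, c) ∧ E c := by
      apply Finset.filter_congr
      intro x _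
      constructor
      · rintro ⟨⟨hq, -, hE⟩, hc⟩
        have hx' : x = (q.1, q.2, c) := by
          rw [← hq, ← hc]
        refine ⟨hx', ?_⟩
        show EBpreP F₁ F₂ c (q.1, q.2, c) ∈ 𝓔
        rw [← hx', ← hc]; exact hE
      · rintro ⟨rfl, hE⟩
        have hcore : F₂.core c = true := core_of_mem_coreAll F₂ hc
        exact ⟨⟨rfl, hcore, hE⟩, rfl⟩
    rw [this, card_filter_single]
  have e2 : ((QPJ J 𝒯).filter fun x => (x.1, x.2.1) = q ∧ F₂.core x.2.2 = true ∧
      EBP F₁ F₂ x ∈ 𝓔).card = ∑ c ∈ coreAll F₂.toFibreData, if P c ∧ E (F₂.flip c) then 1 else 0 := by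
    rw [Finset.card_eq_sum_card_fiberwise (f := fun x => x.2.2) (t := coreAll F₂.toFibreData)
      (fun x hx => mem_coreAll_of_core (Finset.mem_filter.1 hx).2.2.1)]
    refine Finset.sum_congr rfl fun c hc => ?_
    rw [Finset.filter_filter]
    have hcore : F₂.core c = true := core_of_mem_coreAll F₂ hc
    have hEB : EBP F₁ F₂ (q.1, q.2, c) = EBpreP F₁ F₂ (F₂.flip c) (q.1, q.2, F₂.flip c) := by
      rw [EBP_eq_EBpreP]; rfl
    have : ((QPJ J 𝒯).filter fun x => ((x.1, x.2.1) = q ∧ F₂.core x.2.2 = true ∧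
        EBP F₁ F₂ x ∈ 𝓔) ∧ x.2.2 = c) =
        (QPJ J 𝒯).filter fun x => x = (q.1, q.2, c) ∧ E (F₂.flip c) := by
      apply Finset.filter_congr
      intro x _
      constructor
      · rintro ⟨⟨hq, -, hE⟩, hc'⟩
        have hx' : x = (q.1, q.2, c) := by rw [← hq, ← hc']
        refine ⟨hx', ?_⟩
        show EBpreP F₁ F₂ (F₂.flip c) (q.1, q.2, F₂.flip c) ∈ 𝓔
        rw [← hEB, ← hx']; exact hE
      · rintro ⟨rfl, hE⟩
        refine ⟨⟨rfl, hcore, ?_⟩, rfl⟩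
        rw [hEB]
        exact hE
    rw [this, card_filter_single]
  rw [e1, e2]
  have hP : ∀ c ∈ F₂.core0, P (F₂.flip c) → P c := by
    intro c hc h
    have h' : (q.1, q.2, F₂.flip c) ∈ QPJ J 𝒯 := h
    show (q.1, q.2, c) ∈ QPJ J 𝒯
    rw [mem_QPJ] at h' ⊢
    refine ⟨?_, ?_⟩
    · rw [leakP_core_iff F₁ F₂ (F₂.core0_core c hc)]
      rw [leakP_core_iff F₁ F₂ (F₂.core_flip _ (F₂.core0_core c hc))] at h'
      exact h'.1
    · exact h𝒯 _ h'.2 _ ⟨fun _ h => h, J.pairJ q.2 c hc⟩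
  have hE : ∀ c ∈ F₂.core0, E c → E (F₂.flip c) := fun c hc h =>
    h𝓔 (EBpreP_mono F₁ F₂ (F₂.pair_red c hc) _) h
  convert sum_pair_le F₂ P E hP hE using 3

end Frozen

section NonCore

variable {W₁ A₁ L₁ W₂ A₂ L₂ : Type*} {ι : Type*} {F₁ : FibreIter W₁ A₁ L₁}
  {F₂ : FibreDataBit W₂ A₂ L₂} {LJ : Type*} (J : JointLabel F₁ F₂ LJ)

variable [Fintype ι] [DecidableEq ι] [Fintype W₁] [DecidableEq W₁] [Fintype W₂] [DecidableEq W₂]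

open scoped Classical

variable [Nonempty ι]

omit [DecidableEq W₁] [DecidableEq W₂] in
/-- **Step 3, the non-core points of the second component**: the red T-slab points inject into
the blue B-slab points through `theta₁ × psi₂`. -/
lemma card_nc_lePJ {𝒯 : Set (TypG LJ ι)} (h𝒯 : IsUpPJ J 𝒯) {𝓔 : Set (Set (AtomPr A₁ A₂ ι))}
    (h𝓔 : IsUpperSet 𝓔) (hE : (∅ : Set (AtomPr A₁ A₂ ι)) ∉ 𝓔) :
    ((QPJ J 𝒯).filter fun x => F₂.core x.2.2 = false ∧ ERP F₁ F₂ x ∈ 𝓔).card ≤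
      ((QPJ J 𝒯).filter fun x => F₂.core x.2.2 = false ∧ EBP F₁ F₂ x ∈ 𝓔).card := by
  -- every point of the left side is a T-slab point without red-side leak
  have hform : ∀ x ∈ (QPJ J 𝒯).filter fun x => F₂.core x.2.2 = false ∧ ERP F₁ F₂ x ∈ 𝓔,
      x.1 = sTopG ∧ F₁.leakR x.2.1 = false ∧ F₂.leakR x.2.2 = false := by
    intro x hx
    rw [Finset.mem_filter] at hx
    obtain ⟨hx, hc, hE'⟩ := hx
    have hl := ((mem_QPJ J).1 hx).1
    have hs : x.1 = sTopG := by
      rcases top_or_bot_P F₁ F₂ hl hc with hs | hs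
      · exact hs
      · exfalso
        have : ERP F₁ F₂ x = ∅ := by
          rw [show x = (x.1, x.2.1, x.2.2) from rfl, hs]
          exact ERP_sBot F₁ F₂ _ _
        rw [this] at hE'
        exact hE hE'
    refine ⟨hs, ?_, ?_⟩
    · cases h : F₁.leakR x.2.1 with
      | false => rfl
      | true =>
        exfalso
        exact hl (Or.inl (Or.inl ⟨by rw [hs]; exact redUG_top, h⟩))
    · cases h : F₂.leakR x.2.2 with
      | false => rfl
      | true =>
        exfalso
        exact hl (Or.inr (Or.inl ⟨by rw [hs]; exact redUG_top, h⟩))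
  refine Finset.card_le_card_of_injOn
    (fun x => ((sBotG : Config ι), F₁.theta x.2.1, F₂.psi x.2.2)) ?_ ?_
  · intro x hx
    rw [Finset.mem_coe] at hx ⊢
    obtain ⟨hs, hl₁, hl₂⟩ := hform x hx
    have hx' := hx
    rw [Finset.mem_filter] at hx' ⊢
    obtain ⟨hxQ, hc, hE'⟩ := hx'
    obtain ⟨hθl, -, hθred⟩ := F₁.theta_ok x.2.1 hl₁
    obtain ⟨hψl, hψc, -, hψred⟩ := F₂.psi_ok x.2.2 hl₂ hc
    refine ⟨?_, hψc, ?_⟩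
    · rw [mem_QPJ]
      refine ⟨?_, ?_⟩
      · rintro ((⟨⟨j, hj⟩, -⟩ | ⟨-, h2⟩) | ⟨⟨j, hj⟩, -⟩ | ⟨-, h3⟩)
        · exact Bool.noConfusion hj
        · rw [hθl] at h2; exact Bool.noConfusion h2
        · exact Bool.noConfusion hj
        · rw [hψl] at h3; exact Bool.noConfusion h3
      · have ht := ((mem_QPJ J).1 hxQ).2
        have ht' : (x.1, J.labelJ x.2.1 x.2.2) ∈ 𝒯 := ht
        show ((sBotG : Config ι), J.labelJ (F₁.theta x.2.1) (F₂.psi x.2.2)) ∈ 𝒯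
        refine h𝒯 _ ht' _ ⟨fun j hj => ?_, J.ncJ _ _ hl₁ hl₂ hc⟩
        have hj' : x.1 j = false := hj
        rw [hs] at hj'
        exact Bool.noConfusion hj'
    · -- the blue atoms of the image contain the red atoms of the source
      show ERP F₁ F₂ (flipAll (sBotG : Config ι), F₁.flip (F₁.theta x.2.1),
        F₂.flip (F₂.psi x.2.2)) ∈ 𝓔
      rw [flipAll_sBotG]
      have hER : ERP F₁ F₂ x = ERP F₁ F₂ ((sTopG : Config ι), x.2.1, x.2.2) := by
        rw [show x = (x.1, x.2.1, x.2.2) from rfl, hs]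
      rw [hER] at hE'
      exact h𝓔 (ERP_mono_fib F₁ F₂ hθred hψred) hE'
  · intro x hx y hy hxy
    rw [Finset.mem_coe] at hx hy
    obtain ⟨hsx, hlx₁, hlx₂⟩ := hform x hx
    obtain ⟨hsy, hly₁, hly₂⟩ := hform y hy
    have hcx : F₂.core x.2.2 = false := (Finset.mem_filter.1 hx).2.1
    have hcy : F₂.core y.2.2 = false := (Finset.mem_filter.1 hy).2.1
    simp only [Prod.mk.injEq, true_and] at hxy
    have hw₁ := F₁.theta_inj _ _ hlx₁ hly₁ hxy.1
    have hw₂ := F₂.psi_inj _ _ hlx₂ hcx hly₂ hcy hxy.2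
    rw [show x = (x.1, x.2.1, x.2.2) from rfl, show y = (y.1, y.2.1, y.2.2) from rfl, hsx, hsy,
      hw₁, hw₂]

end NonCore

section Assembly

variable {W₁ A₁ L₁ W₂ A₂ L₂ : Type*} {ι : Type*} {F₁ : FibreIter W₁ A₁ L₁}
  {F₂ : FibreDataBit W₂ A₂ L₂} {LJ : Type*} (J : JointLabel F₁ F₂ LJ)
variable [Fintype ι] [DecidableEq ι] [Fintype W₁] [DecidableEq W₁] [Fintype W₂] [DecidableEq W₂]

open scoped Classical

variable [Nonempty ι]

omit [DecidableEq W₁] in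
/-- **THE ABSTRACT THEOREM OF BOUNDARY (iv) FOR THE PRODUCT OF TWO COMPONENTS WITH A JOINT
LABEL**: on every up-set of joint types, the red count is at most the blue count for every up-set
of atom sets, given the inequality of the first factor. -/
theorem ineq_prodL_aux (hineq : Ineq F₁ (ι := ι)) {𝒯 : Set (TypG LJ ι)} (h𝒯 : IsUpPJ J 𝒯)
    {𝓔 : Set (Set (AtomPr A₁ A₂ ι))} (h𝓔 : IsUpperSet 𝓔) :
    ((QPJ J 𝒯).filter fun x => ERP F₁ F₂ x ∈ 𝓔).card ≤
      ((QPJ J 𝒯).filter fun x => EBP F₁ F₂ x ∈ 𝓔).card := by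
  by_cases hE : (∅ : Set (AtomPr A₁ A₂ ι)) ∈ 𝓔
  · have hall : ∀ S : Set (AtomPr A₁ A₂ ι), S ∈ 𝓔 := fun S => h𝓔 (Set.empty_subset S) hE
    rw [Finset.filter_true_of_mem fun _ _ => hall _, Finset.filter_true_of_mem fun _ _ => hall _]
  -- split both sides along the core of the second component
  have hR := Finset.card_filter_add_card_filter_not (s := (QPJ J 𝒯).filter fun x => ERP F₁ F₂ x ∈ 𝓔)
    (fun x => F₂.core x.2.2 = true)
  have hB := Finset.card_filter_add_card_filter_not (s := (QPJ J 𝒯).filter fun x => EBP F₁ F₂ x ∈ 𝓔)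
    (fun x => F₂.core x.2.2 = true)
  simp only [Finset.filter_filter] at hR hB
  -- the non-core points
  have hnc := card_nc_lePJ J h𝒯 h𝓔 hE
  have hcf : ∀ c : Bool, ¬ c = true ↔ c = false := fun c => by cases c <;> simp
  have ex1 : ((QPJ J 𝒯).filter fun x => ERP F₁ F₂ x ∈ 𝓔 ∧ ¬ F₂.core x.2.2 = true) =
      (QPJ J 𝒯).filter fun x => F₂.core x.2.2 = false ∧ ERP F₁ F₂ x ∈ 𝓔 :=
    Finset.filter_congr fun x _ => by rw [hcf, and_comm]
  have ex2 : ((QPJ J 𝒯).filter fun x => EBP F₁ F₂ x ∈ 𝓔 ∧ ¬ F₂.core x.2.2 = true) =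
      (QPJ J 𝒯).filter fun x => F₂.core x.2.2 = false ∧ EBP F₁ F₂ x ∈ 𝓔 :=
    Finset.filter_congr fun x _ => by rw [hcf, and_comm]
  rw [ex1] at hR
  rw [ex2] at hB
  -- the core points: fibre by the point of the second component
  have c1 : ((QPJ J 𝒯).filter fun x => ERP F₁ F₂ x ∈ 𝓔 ∧ F₂.core x.2.2 = true).card =
      ∑ c ∈ coreAll F₂.toFibreData, ((QPJ J 𝒯).filter fun x => x.2.2 = c ∧ ERP F₁ F₂ x ∈ 𝓔).card := by
    rw [Finset.card_eq_sum_card_fiberwise (f := fun x => x.2.2) (t := coreAll F₂.toFibreData)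
      (fun x hx => mem_coreAll_of_core (Finset.mem_filter.1 hx).2.2)]
    refine Finset.sum_congr rfl fun c hc => ?_
    rw [Finset.filter_filter]
    congr 1
    apply Finset.filter_congr
    intro x _
    constructor
    · rintro ⟨⟨hE', -⟩, hc'⟩
      exact ⟨hc', hE'⟩
    · rintro ⟨hc', hE'⟩
      exact ⟨⟨hE', by rw [hc']; exact core_of_mem_coreAll F₂ hc⟩, hc'⟩
  have c2 : ((QPJ J 𝒯).filter fun x => F₂.core x.2.2 = true ∧ EBpreP F₁ F₂ x.2.2 x ∈ 𝓔).card =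
      ∑ c ∈ coreAll F₂.toFibreData,
        ((QPJ J 𝒯).filter fun x => x.2.2 = c ∧ EBpreP F₁ F₂ c x ∈ 𝓔).card := by
    rw [Finset.card_eq_sum_card_fiberwise (f := fun x => x.2.2) (t := coreAll F₂.toFibreData)
      (fun x hx => mem_coreAll_of_core (Finset.mem_filter.1 hx).2.1)]
    refine Finset.sum_congr rfl fun c hc => ?_
    rw [Finset.filter_filter]
    congr 1
    apply Finset.filter_congr
    intro x _
    constructor
    · rintro ⟨⟨-, hE'⟩, hc'⟩
      refine ⟨hc', ?_⟩
      rw [← hc']; exact hE'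
    · rintro ⟨hc', hE'⟩
      refine ⟨⟨by rw [hc']; exact core_of_mem_coreAll F₂ hc, ?_⟩, hc'⟩
      rw [hc']; exact hE'
  have c3 : ((QPJ J 𝒯).filter fun x => F₂.core x.2.2 = true ∧ EBpreP F₁ F₂ x.2.2 x ∈ 𝓔).card =
      ∑ q : PtG W₁ ι, ((QPJ J 𝒯).filter fun x =>
        (x.1, x.2.1) = q ∧ F₂.core x.2.2 = true ∧ EBpreP F₁ F₂ x.2.2 x ∈ 𝓔).card := by
    rw [Finset.card_eq_sum_card_fiberwise (f := fun x => (x.1, x.2.1)) (t := Finset.univ)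
      (fun _ _ => Finset.mem_univ _)]
    refine Finset.sum_congr rfl fun q _ => ?_
    rw [Finset.filter_filter]
    congr 1
    apply Finset.filter_congr
    intro x _
    exact and_comm
  have c4 : ((QPJ J 𝒯).filter fun x => EBP F₁ F₂ x ∈ 𝓔 ∧ F₂.core x.2.2 = true).card =
      ∑ q : PtG W₁ ι, ((QPJ J 𝒯).filter fun x =>
        (x.1, x.2.1) = q ∧ F₂.core x.2.2 = true ∧ EBP F₁ F₂ x ∈ 𝓔).card := by
    rw [Finset.card_eq_sum_card_fiberwise (f := fun x => (x.1, x.2.1)) (t := Finset.univ)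
      (fun _ _ => Finset.mem_univ _)]
    refine Finset.sum_congr rfl fun q _ => ?_
    rw [Finset.filter_filter]
    congr 1
    apply Finset.filter_congr
    intro x _
    constructor
    · rintro ⟨⟨hE', hc⟩, hq⟩
      exact ⟨hq, hc, hE'⟩
    · rintro ⟨hq, hc, hE'⟩
      exact ⟨⟨hE', hc⟩, hq⟩
  have hcore : ((QPJ J 𝒯).filter fun x => ERP F₁ F₂ x ∈ 𝓔 ∧ F₂.core x.2.2 = true).card ≤
      ((QPJ J 𝒯).filter fun x => EBP F₁ F₂ x ∈ 𝓔 ∧ F₂.core x.2.2 = true).card :=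
    calc ((QPJ J 𝒯).filter fun x => ERP F₁ F₂ x ∈ 𝓔 ∧ F₂.core x.2.2 = true).card
        = ∑ c ∈ coreAll F₂.toFibreData,
            ((QPJ J 𝒯).filter fun x => x.2.2 = c ∧ ERP F₁ F₂ x ∈ 𝓔).card := c1
      _ ≤ ∑ c ∈ coreAll F₂.toFibreData,
            ((QPJ J 𝒯).filter fun x => x.2.2 = c ∧ EBpreP F₁ F₂ c x ∈ 𝓔).card :=
          Finset.sum_le_sum fun c hc =>
            card_frozen_lePJ J hineq h𝒯 h𝓔 c (core_of_mem_coreAll F₂ hc)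
      _ = ((QPJ J 𝒯).filter fun x => F₂.core x.2.2 = true ∧ EBpreP F₁ F₂ x.2.2 x ∈ 𝓔).card :=
          c2.symm
      _ = ∑ q : PtG W₁ ι, ((QPJ J 𝒯).filter fun x =>
            (x.1, x.2.1) = q ∧ F₂.core x.2.2 = true ∧ EBpreP F₁ F₂ x.2.2 x ∈ 𝓔).card := c3
      _ ≤ ∑ q : PtG W₁ ι, ((QPJ J 𝒯).filter fun x =>
            (x.1, x.2.1) = q ∧ F₂.core x.2.2 = true ∧ EBP F₁ F₂ x ∈ 𝓔).card :=
          Finset.sum_le_sum fun q _ => card_pairPJ_le J h𝒯 h𝓔 q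
      _ = ((QPJ J 𝒯).filter fun x => EBP F₁ F₂ x ∈ 𝓔 ∧ F₂.core x.2.2 = true).card := c4.symm
  omega

omit [DecidableEq W₁] [DecidableEq W₂] in
/-- **The inequality of the product with a joint label.** -/
theorem ineq_prodL (hineq : Ineq F₁ (ι := ι)) : Ineq (F₁.prodL F₂ J) (ι := ι) := by
  intro 𝒯 𝓔 h𝒯 h𝓔
  have e1 : ((QI (F₁.prodL F₂ J) 𝒯).filter fun q => ERI (F₁.prodL F₂ J) q ∈ 𝓔) =
      (QPJ J 𝒯).filter fun x => ERP F₁ F₂ x ∈ 𝓔 := by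
    rw [QI_prodL]
    exact Finset.filter_congr fun x _ => by rw [ERI_prodL_eq]
  have e2 : ((QI (F₁.prodL F₂ J) 𝒯).filter fun q => EBI (F₁.prodL F₂ J) q ∈ 𝓔) =
      (QPJ J 𝒯).filter fun x => EBP F₁ F₂ x ∈ 𝓔 := by
    rw [QI_prodL]
    exact Finset.filter_congr fun x _ => by rw [EBI_prodL]
  rw [e1, e2]
  exact ineq_prodL_aux J hineq (isUpPJ_of_isUpI F₁ F₂ J h𝒯) h𝓔

end Assembly

end CrossArm

end Summit.Ventures.PercRepro2
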